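import Mathlib
import HarnessLib
import Literature.NumberTheory.LFunctions.HorocycleRH
import Literature.NumberTheory.LFunctions.HorocycleZeroMode
import Literature.NumberTheory.LFunctions.CoprimeResidueSums

/-!
# The unconditional rate `O(y^{1/2})` for closed horocycles on `SL(2,ℤ)\ℍ`: skeleton and assembly

Topic `Literature/NumberTheory/LFunctions`. This file organises an ELEMENTARY proof of the named
fact `Literature.NumberTheory.LFunctions.zagier_horocycle_rate_half` (`HorocycleRH.lean`;
Sarnak 1981, Thm. 1; Zagier 1981, §1 p. 279): for `F` smooth on `ℍ`, `SL(2,ℤ)`-invariant and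
vanishing high in the cusp, `∫₀¹ F(x+iy) dx = c + O(y^{1/2})` as `y → 0⁺`.

Sarnak's and Zagier's proofs go through the spectral decomposition of `L²(Γ\ℍ)` / the
meromorphic continuation of `E(z,s)`, neither of which Mathlib has. The proof organised here
uses only unfolding and Poisson-type elementary analysis:

1. **Partition of unity and unfolding** (`HorocycleUnfolding`). With a smooth cut-off `χ₀`
   (`= 0` on `(-∞, 1/2]`, `= 1` on `[3/4, ∞)`) and the incomplete Eisenstein series
   `E₀ = ∑_{(c,d)=1} χ₀(im z/|cz+d|²) ≥ 1`, the function `f = F χ₀(im ·)/E₀` is smooth on `ℍ`,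
   `1`-periodic, supported in `1/2 < im ≤ max Y 1` (`IsStripFun`), and `F = ∑_{(c,d)=1} f ∘ γ_{c,d}`.
   Unfolding the double cosets `Γ∞\Γ/Γ∞` on the segment `[0,1] + iy` (Iwaniec, *Spectral
   methods*, §2.4, §3.4) gives, for `0 < y < 1/2` and `N ≥ √(2/y)`,
   `∫₀¹ F(x+iy) dx = 2y ∑_{c=1}^{N} ∑_{a mod c, (a,c)=1} Φ_f(c²y, a/c)`,
   `Φ_g(w, θ) = ∫_ℝ g(θ + (-t+i)/(w(1+t²))) dt` (`arcTransform`), the integral of `g` over the horocycle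
   of euclidean diameter `1/w` tangent to `ℝ` at `θ`, in the unfolded parameter.
2. **Fourier analysis on the arcs** (`ArcFourierBound`). For `g` in the class `IsStripFun`,
   `θ ↦ Φ_g(w,θ)` is smooth and `1`-periodic with Fourier coefficients
   `b_k(w) = ∫_ℝ e(-k t H) ĝ_k(H) dt`, `H = 1/(w(1+t²))`, `ĝ_k(h) = ∫₀¹ g(θ+ih) e(-kθ) dθ`, and
   `‖b_k(w)‖ ≤ M/|k|³` UNIFORMLY in `w > 0` (three integrations by parts in `θ`; for small `w`
   one more in `t`, where the phase `tH(t)` has `|d/dt| ≥ H/2` on the support `|t| ≥ √3`); the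
   zero mode is `u b₀(u²) = k₀(u)` with `k₀(u) = ∫_ℝ ĝ₀(1/(u²+s²)) ds` smooth and `= 0` on `[2,∞)`.
3. **Arithmetic averages** (in the tree, PROVED): `CoprimeResidueSums.norm_sum_coprime_sub_le`
   (`∑*_{a mod c} Φ(w,a/c) = φ(c) b₀(w) + O(8M)`, Ramanujan sums) and
   `HorocycleZeroMode.zeroMode_bound` (`∑_c (φ(c)/c) k₀(lc) = (∑_d μ(d)/d²)(∫₀² k₀)/l + O(1)`).
4. **Assembly** (`zagier_horocycle_rate_half_of`, PROVED here): with `l = √y`, `N = ⌈2/l⌉`,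
   `∫₀¹ F(x+iy) dx = 2 (∑_d μ(d)/d²) ∫₀² k₀ + O((2C + 48M) √y)` on `0 < y < 1/2`.

Steps 1 and 2 are recorded below as named facts (`def … : Prop`, D-0014) and are discharged in
the sibling files `HorocycleRateHalfUnfolding.lean` and `HorocycleRateHalfArcBound.lean`
(with `HorocycleRateHalfStrip.lean`; both bridge to the twin files `HorocyclePhase.lean`,
`HorocycleUnfolding.lean`, `HorocycleZeroKernel.lean`); the final
`zagier_horocycle_rate_half_holds` (`HorocycleRateHalfProofs.lean`) is their composition with
`zagier_horocycle_rate_half_of`.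

## References

* P. Sarnak, *Asymptotic behavior of periodic orbits of the horocycle flow and Eisenstein
  series*, Comm. Pure Appl. Math. 34 (1981), 719–739, Thm. 1 [Sarnak1981].
* D. Zagier, *Eisenstein series and the Riemann zeta function*, in: Automorphic forms,
  representation theory and arithmetic (Bombay 1979), Springer 1981, 275–301, §1 [Zagier1981].
* H. Iwaniec, *Spectral Methods of Automorphic Forms*, 2nd ed., AMS GSM 53 (2002), §2.4, §3.2,
  §3.4 [Iwaniec2002].

## Mathlib / tree search

Mathlib: `ModularGroup.fd`, `EisensteinSeries.gammaSet`, `Real.smoothTransition`,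
`hasSum_fourier_series_of_summable`; nothing on horocycle averages
(`lean search 'horocycl'`: only this topic's files). Tree: `incEis`, `horocycleAverage_incEis`
(`HorocycleRHIncompleteEisenstein.lean`), `HorocycleZeroMode.zeroMode_bound`,
`CoprimeResidueSums.norm_sum_coprime_sub_le`.
-/

noncomputable section

open Real Complex MeasureTheory Set Filter Asymptotics
open scoped MatrixGroups UpperHalfPlane Topology ArithmeticFunction.Moebius

namespace Literature.NumberTheory.LFunctions

/-! ### The test-function class on the strip and the arc transform -/

/-- **Test functions on the strip.** `IsStripFun Y₁ g`: `g : ℂ → ℂ` is `C^∞` on the upper half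
plane, `1`-periodic, and vanishes for `im z < 1/2` and for `im z > Y₁` — the shape of the
automorphized function `F χ₀(im ·)/E₀` of a smooth `Γ`-invariant cusp-supported `F`
(Iwaniec, *Spectral methods*, §3.2: functions on `Γ∞\ℍ` of compact support). [folklore] -/
structure IsStripFun (Y₁ : ℝ) (g : ℂ → ℂ) : Prop where
  smooth : ContDiffOn ℝ (⊤ : ℕ∞) g {z : ℂ | 0 < z.im}
  periodic : ∀ z : ℂ, g (z + 1) = g z
  zero_of_im_lt : ∀ z : ℂ, z.im < 1 / 2 → g z = 0
  zero_of_lt_im : ∀ z : ℂ, Y₁ < z.im → g z = 0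

/-- The point `(-t + i)/(w(1+t²)) = -1/(w(t+i))` of the horocycle of euclidean diameter `1/w`
tangent to `ℝ` at `0`, parametrised by `t ∈ ℝ` (the image of the horizontal line `im = y` under
`z ↦ -1/(c² z)`, `w = c² y`, `z = y(t + i)`). [folklore] -/
def arcPt (w t : ℝ) : ℂ := ⟨-t / (w * (1 + t ^ 2)), 1 / (w * (1 + t ^ 2))⟩

/-- **Arc transform** `Φ_g(w, θ) = ∫_ℝ g(θ + (-t+i)/(w(1+t²))) dt`: the integral of `g` over the
horocycle of diameter `1/w` at the cusp `θ`, in the unfolded parameter `t`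
(Iwaniec §3.4; for `g = ψ(im ·)` this is `G(w) = ∫ ψ(1/(w(1+t²))) dt` of
`HorocycleRHProofs.lean`). [folklore] -/
def arcTransform (g : ℂ → ℂ) (w θ : ℝ) : ℂ := ∫ t : ℝ, g ((θ : ℂ) + arcPt w t)

/-! ### The two analytic inputs as named facts -/

/-- NAMED FACT (technical; discharged in `HorocycleRateHalfUnfolding.lean`). **Partition of unity and
unfolding of the closed horocycle.** For `F : ℂ → ℂ` smooth on `{im > 0}`, `SL(2,ℤ)`-invariant
on `ℍ` and vanishing on `𝒟 ∩ {im > Y}`, there is a strip test function `g` (`IsStripFun (max Y 1) g`;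
namely `g = F χ₀(im ·)/E₀`) such that for `0 < y < 1/2` and every `N ≥ √(2/y)`,
`∫₀¹ F(x+iy) dx = 2y ∑_{c=1}^{N} ∑_{0 ≤ a < c, (a,c)=1} Φ_g(c² y, a/c)`
(unfolding of `Γ∞\Γ/Γ∞`, Iwaniec, *Spectral methods*, §2.4 and §3.4). [folklore] -/
def HorocycleUnfolding : Prop :=
  ∀ F : ℂ → ℂ, ContDiffOn ℝ (⊤ : ℕ∞) F {z : ℂ | 0 < z.im} →
    (∀ (g : Matrix.SpecialLinearGroup (Fin 2) ℤ) (z : UpperHalfPlane), F ↑(g • z) = F ↑z) →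
    ∀ Y : ℝ, (∀ z : UpperHalfPlane, z ∈ ModularGroup.fd → Y < z.im → F ↑z = 0) →
      ∃ g : ℂ → ℂ, IsStripFun (max Y 1) g ∧
        ∀ y : ℝ, 0 < y → y < 1 / 2 → ∀ N : ℕ, Real.sqrt (2 / y) ≤ N →
          ∫ x in (0 : ℝ)..1, F (↑x + ↑y * Complex.I) =
            2 * (y : ℂ) * ∑ c ∈ Finset.Ioc 0 N,
              ∑ a ∈ (Finset.range c).filter (fun a => Nat.Coprime c a),
                arcTransform g ((c : ℝ) ^ 2 * y) ((a : ℝ) / c)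

/-- NAMED FACT (technical; discharged in `HorocycleRateHalfArcBound.lean`). **Fourier expansion of
the arc transform with uniform coefficient bounds.** For a strip test function `g` there are
coefficients `b_k(w)` and a constant `M` with `Φ_g(w,θ) = ∑_k b_k(w) e(kθ)` (pointwise, every
`w > 0`), `∑_k |b_k(w)| < ∞`, `‖b_k(w)‖ ≤ M/|k|³` for `k ≠ 0` uniformly in `w > 0`, and the zero
mode is `u b₀(u²) = k₀(u)` (`u > 0`) for a `C²` function `k₀` vanishing on `[2, ∞)`
(`k₀(u) = ∫ ĝ₀(1/(u²+s²)) ds`). [folklore] -/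
def ArcFourierBound : Prop :=
  ∀ (Y₁ : ℝ) (g : ℂ → ℂ), IsStripFun Y₁ g →
    ∃ (b : ℤ → ℝ → ℂ) (M : ℝ),
      (∀ w : ℝ, 0 < w → ∀ θ : ℝ,
        HasSum (fun k : ℤ => b k w * Complex.exp (2 * π * I * k * θ)) (arcTransform g w θ)) ∧
      (∀ w : ℝ, 0 < w → Summable fun k : ℤ => b k w) ∧
      (∀ w : ℝ, 0 < w → ∀ k : ℤ, k ≠ 0 → ‖b k w‖ ≤ M / |(k : ℝ)| ^ 3) ∧
      ∃ k₀ : ℝ → ℂ, ContDiff ℝ 2 k₀ ∧ (∀ s : ℝ, 2 ≤ s → k₀ s = 0) ∧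
        ∀ u : ℝ, 0 < u → (u : ℂ) * b 0 (u ^ 2) = k₀ u

/-! ### Assembly -/

/-- Bookkeeping for the number of rows: with `l = √y ∈ (0,1)` and `N = ⌈2/l⌉₊` one has
`2 ≤ l N`, `N ≤ 2/l + 1` and `√(2/y) ≤ N`. [folklore] -/
theorem rows_aux {y : ℝ} (hy : 0 < y) (hy1 : y < 1) :
    0 < Real.sqrt y ∧ Real.sqrt y < 1 ∧ (Real.sqrt y) ^ 2 = y ∧
      2 ≤ Real.sqrt y * (⌈2 / Real.sqrt y⌉₊ : ℕ) ∧
      ((⌈2 / Real.sqrt y⌉₊ : ℕ) : ℝ) ≤ 2 / Real.sqrt y + 1 ∧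
      Real.sqrt (2 / y) ≤ ((⌈2 / Real.sqrt y⌉₊ : ℕ) : ℝ) := by
  have hl : 0 < Real.sqrt y := Real.sqrt_pos.mpr hy
  have hl1 : Real.sqrt y < 1 := by
    rw [← Real.sqrt_one]; exact Real.sqrt_lt_sqrt hy.le hy1
  have hsq : (Real.sqrt y) ^ 2 = y := Real.sq_sqrt hy.le
  have hceil : 2 / Real.sqrt y ≤ ((⌈2 / Real.sqrt y⌉₊ : ℕ) : ℝ) := Nat.le_ceil _
  refine ⟨hl, hl1, hsq, ?_, ?_, ?_⟩
  · calc (2 : ℝ) = Real.sqrt y * (2 / Real.sqrt y) := by field_simp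
      _ ≤ Real.sqrt y * ((⌈2 / Real.sqrt y⌉₊ : ℕ) : ℝ) := by gcongr
  · exact (Nat.ceil_lt_add_one (by positivity)).le
  · refine le_trans ?_ hceil
    rw [Real.sqrt_div' 2 hy.le, div_le_div_iff₀ hl hl]
    have h2 : Real.sqrt 2 ≤ 2 := by
      rw [show (2 : ℝ) = Real.sqrt 4 by
        rw [show (4 : ℝ) = 2 ^ 2 by norm_num, Real.sqrt_sq (by norm_num : (0:ℝ) ≤ 2)]]
      exact Real.sqrt_le_sqrt (by norm_num)
    nlinarith

/-- **Assembly of the elementary proof** of `zagier_horocycle_rate_half` from the unfolding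
identity and the arc-Fourier bounds (both named facts above), the reduced-residue sums of
`CoprimeResidueSums.lean` and the zero-mode lemma of `HorocycleZeroMode.lean`: with
`l = √y`, `N = ⌈2/l⌉₊`,
`∫₀¹ F(x+iy) dx = 2y ∑_{c ≤ N} (φ(c) b₀(c²y) + O(8M)) = 2l ∑_{c ≤ N} (φ(c)/c) k₀(lc) + O(48 M l)`
`= 2 (∑_d μ(d)/d²) ∫₀² k₀ + O((2C + 48M) l)`. Real proof. [folklore] -/
theorem zagier_horocycle_rate_half_of (hU : HorocycleUnfolding) (hA : ArcFourierBound) :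
    zagier_horocycle_rate_half := by
  intro F hF hinv hsupp
  obtain ⟨Y, hY⟩ := hsupp
  obtain ⟨g, hg, hunf⟩ := hU F hF hinv Y hY
  obtain ⟨b, M, hsum, hsumm, hbd, k₀, hk₀, hk₀R, hk₀b⟩ := hA (max Y 1) g hg
  obtain ⟨C, hC⟩ := HorocycleZeroMode.zeroMode_bound hk₀ two_pos hk₀R
  set S : ℂ := ∑' d : ℕ, (μ d : ℂ) / (d : ℂ) ^ 2 with hS
  set I₀ : ℂ := ∫ s in (0 : ℝ)..2, k₀ s with hI₀
  refine ⟨2 * S * I₀, ?_⟩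
  -- signs of the constants
  have hM0 : 0 ≤ M := by
    have h := hbd 1 one_pos 1 one_ne_zero
    simp only [Int.cast_one, abs_one, one_pow, div_one] at h
    exact (norm_nonneg _).trans h
  have hC0 : 0 ≤ C := by
    have h := hC 2 two_pos 1 (by norm_num)
    exact (norm_nonneg _).trans h
  refine IsBigO.of_bound (2 * C + 48 * M) ?_
  filter_upwards [Ioo_mem_nhdsGT (show (0 : ℝ) < 1 / 2 by norm_num)] with y hy
  obtain ⟨hy0, hy2⟩ := hy
  have hy1 : y < 1 := by linarith
  obtain ⟨hl, hl1, hsq, hlN, hNle, hN2⟩ := rows_aux hy0 hy1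
  set l : ℝ := Real.sqrt y with hl_def
  set N : ℕ := ⌈2 / l⌉₊ with hN_def
  -- Step 1: unfolding
  rw [hunf y hy0 hy2 N hN2]
  -- Step 2: the rows, `∑*_{a mod c} Φ(c²y, a/c) = φ(c) b₀(c²y) + O(8M)`
  have hrow : ∀ c ∈ Finset.Ioc 0 N,
      ‖∑ a ∈ (Finset.range c).filter (fun a => Nat.Coprime c a), arcTransform g ((c : ℝ) ^ 2 * y) ((a : ℝ) / c) -
        (Nat.totient c : ℂ) * b 0 ((c : ℝ) ^ 2 * y)‖ ≤ 8 * M := by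
    intro c hc
    have hc0 : 0 < c := (Finset.mem_Ioc.mp hc).1
    have hw : 0 < (c : ℝ) ^ 2 * y := by positivity
    exact CoprimeResidueSums.norm_sum_coprime_sub_le (hsum _ hw) (hsumm _ hw)
      (fun k hk => hbd _ hw k hk) hc0
  have hE₁ : ‖∑ c ∈ Finset.Ioc 0 N, ∑ a ∈ (Finset.range c).filter (fun a => Nat.Coprime c a),
        arcTransform g ((c : ℝ) ^ 2 * y) ((a : ℝ) / c) -
      ∑ c ∈ Finset.Ioc 0 N, (Nat.totient c : ℂ) * b 0 ((c : ℝ) ^ 2 * y)‖ ≤ N * (8 * M) := by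
    rw [← Finset.sum_sub_distrib]
    calc _ ≤ ∑ c ∈ Finset.Ioc 0 N, ‖∑ a ∈ (Finset.range c).filter (fun a => Nat.Coprime c a),
          arcTransform g ((c : ℝ) ^ 2 * y) ((a : ℝ) / c) - (Nat.totient c : ℂ) * b 0 ((c : ℝ) ^ 2 * y)‖ :=
          norm_sum_le _ _
      _ ≤ ∑ c ∈ Finset.Ioc 0 N, 8 * M := Finset.sum_le_sum hrow
      _ = N * (8 * M) := by simp
  -- Step 3: the zero mode, `φ(c) b₀(c²y) = (1/l) (φ(c)/c) k₀(lc)`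
  have hzero : ∑ c ∈ Finset.Ioc 0 N, (Nat.totient c : ℂ) * b 0 ((c : ℝ) ^ 2 * y) =
      (1 / (l : ℂ)) * ∑ c ∈ Finset.Ioc 0 N, ((Nat.totient c : ℂ) / c) * k₀ (l * c) := by
    rw [Finset.mul_sum]
    refine Finset.sum_congr rfl fun c hc => ?_
    have hc0 : 0 < c := (Finset.mem_Ioc.mp hc).1
    have hc0' : (0 : ℝ) < c := by exact_mod_cast hc0
    have hlc : 0 < l * c := mul_pos hl hc0'
    have hk := hk₀b (l * c) hlc
    have e1 : (l * c) ^ 2 = (c : ℝ) ^ 2 * y := by rw [mul_pow, hsq]; ring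
    rw [e1] at hk
    rw [← hk]
    have hl0 : (l : ℂ) ≠ 0 := by exact_mod_cast hl.ne'
    have hc0'' : (c : ℂ) ≠ 0 := by exact_mod_cast hc0.ne'
    push_cast
    field_simp
  have hE₂ := hC l hl N hlN
  -- Step 4: combine
  set T₁ : ℂ := ∑ c ∈ Finset.Ioc 0 N, ∑ a ∈ (Finset.range c).filter (fun a => Nat.Coprime c a),
      arcTransform g ((c : ℝ) ^ 2 * y) ((a : ℝ) / c) with hT₁
  set T₂ : ℂ := ∑ c ∈ Finset.Ioc 0 N, ((Nat.totient c : ℂ) / c) * k₀ (l * c) with hT₂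
  set T₃ : ℂ := ∑ c ∈ Finset.Ioc 0 N, (Nat.totient c : ℂ) * b 0 ((c : ℝ) ^ 2 * y) with hT₃
  have hl0 : (l : ℂ) ≠ 0 := by exact_mod_cast hl.ne'
  have hyl : (y : ℂ) = (l : ℂ) ^ 2 := by rw [← hsq]; push_cast; ring
  have key : 2 * (y : ℂ) * T₁ - 2 * S * I₀ =
      2 * (y : ℂ) * (T₁ - T₃) + 2 * (l : ℂ) * (T₂ - S * I₀ / l) := by
    rw [hzero, hyl]
    field_simp
    ring
  rw [key]
  have hnl : ‖(fun y : ℝ => y ^ ((1 : ℝ) / 2)) y‖ = l := by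
    simp only [hl_def]
    rw [Real.norm_of_nonneg (Real.rpow_nonneg hy0.le _), Real.sqrt_eq_rpow]
  rw [hnl]
  have hyle : y ≤ l := by nlinarith
  have hyl' : y / l = l := by rw [div_eq_iff hl.ne', ← hsq]; ring
  calc ‖2 * (y : ℂ) * (T₁ - T₃) + 2 * (l : ℂ) * (T₂ - S * I₀ / l)‖
      ≤ ‖2 * (y : ℂ) * (T₁ - T₃)‖ + ‖2 * (l : ℂ) * (T₂ - S * I₀ / l)‖ := norm_add_le _ _
    _ ≤ 2 * y * (N * (8 * M)) + 2 * l * C := by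
        rw [norm_mul, norm_mul, norm_mul, norm_mul, Complex.norm_real, Complex.norm_real,
          Real.norm_of_nonneg hy0.le, Real.norm_of_nonneg hl.le]
        norm_num
        gcongr
    _ ≤ 2 * y * ((2 / l + 1) * (8 * M)) + 2 * l * C := by gcongr
    _ = 32 * M * (y / l) + 16 * M * y + 2 * l * C := by ring
    _ = 32 * M * l + 16 * M * y + 2 * l * C := by rw [hyl']
    _ ≤ 32 * M * l + 16 * M * l + 2 * l * C := by gcongr
    _ = (2 * C + 48 * M) * l := by ring

end Literature.NumberTheory.LFunctions

end
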